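import Summits.AtomisticToContinuum.Crystallization.Theorems.ShellsToBarlowChart.Negative.Calibration

/-!
# `ShellsToBarlowChart` (stmt-AtomisticToContinuum-9227), negative side V: stub checks of the line
# `develop-the-model-growth-descent` (unit `drefute-stmt-AtomisticToContinuum-9227`)

Skeleton `Cruxes/ShellsToBarlowChart/Lines/develop_the_model_growth_descent.lean` (lead reshape,
cycle 1, seven stubs); its local `def`s are not importable, so the interfaces are spelt out VERBATIM
below with `B = barlowStacking 1 √(2/3) s`.

§1–3: stub 4, `stub_powerTranslation : IsHaggSeq s → IsContactAut s σ → (∀ q ∈ B, σ q ≠ q) →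
(∀ q ∈ B, dist q (σ q) ≠ 1) → (∀ q ∈ B, ∀ m ∈ B, dist q m = 1 → dist m (σ q) ≠ 1) → ∃ τ ≠ 0, …`.
* `powerTranslation_false_without_far` — drop the THIRD displacement hypothesis (graph distance
  `≠ 2`) and the statement is FALSE: in the ideal FCC stacking the point reflection `x ↦ q₀ − x`
  through the centre `q₀/2` of an octahedral hole (`q₀ = barlowPos 1 (−1) (−1)`, `dist 0 q₀ = √2`)
  is a contact automorphism (`(k,i,j) ↦ (1−k, −1−i, −1−j)`) with no fixed site that never moves a
  site by `1`, yet it is an involution, so no power of it is a non-zero translation.  This is the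
  boundary case of the line's torsion argument (fixed point at distance EQUAL to the covering radius
  `1/√2`, displacement exactly `√2` = graph distance `2`): the hypothesis cannot be weakened to
  "graph distance `≥ 2`", and any proof must use it.
* `powerTranslation_hyps_of_far` — conversely hypotheses 1–2 are IMPLIED by hypothesis 3 for every
  Hägg `s` and site-preserving `σ` (every site has a contact, `dist_barlowPos_succ_eq`; a contact
  pair has four common contacts, `ncard_commonTouching_eq_four`): they are decoration.
* `powerTranslation_hyps_satisfiable` — non-vacuity: the in-layer translation by `3u` satisfies all
  hypotheses (displacement `3`) and attains the conclusion with `n = 1`, for every `s`.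

§4: the interface `TransportSystem S` of stubs 2a/2b. `transportSystem_barlowStacking` — for every
Hägg `s` the ideal stacking is a transport system over ITSELF (frames `ℤ³`, coordinate shifts,
`par (k,i,j) = s k`): the interface is inhabited by the intended model with the skeleton's sign
conventions (`linkOffsets (par (V⁻¹ f)) (par f)`; frame `V^r (J^(−Q) (I^(−P) f))` at `(k,i,j)` is
`relPos k i j (r,P,Q)`), so `stub_transportSystem` excludes no ideal stacking and
`stub_developCovering`'s dictionary is the right way round.  All `[folklore]`.
-/

noncomputable section

namespace Summit.AtomisticToContinuum.Crystallization.Theorems.ShellsToBarlowChartNegative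

open Literature.Geometry.DiscreteGeometry Literature.MathematicalPhysics.StatisticalMechanics
open Summit.AtomisticToContinuum.Crystallization.Theses.PalmUnimodularRigidity

/-- Euclidean `3`-space. -/
local notation "E3" => EuclideanSpace ℝ (Fin 3)

/-- The ideal FCC stacking `barlowStacking 1 √(2/3) constHagg` (the model at `s = constHagg`). -/
local notation "𝔽" => barlowStacking (1 : ℝ) (Real.sqrt (2 / 3)) constHagg

/-! ## Bonds of the ideal FCC stacking in stacking coordinates
(restated from `Negative/HaggWord.lean` under fresh names, that module not being built on the farm) -/

/-- The ideal spacing relation at scale `1`: `h² = ⅔` for `h = √(2/3)`. [folklore] -/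
theorem idealHeight_sq : Real.sqrt (2 / 3) ^ 2 = 2 / 3 * (1 : ℝ) ^ 2 := by
  rw [Real.sq_sqrt (by norm_num)]; ring

/-- **Bonds of the FCC stacking in stacking coordinates**: relative layer `r = k − kp ∈ {0, ±1}`
and in-layer offset in `sixOffsets` / `threeOffsets ∓1`. [cite: HalesDSP2012, §1.3] -/
theorem fcc_bond_iff (kp ip jp k i j : ℤ) :
    dist (barlowPos 1 (Real.sqrt (2 / 3)) constHagg kp ip jp)
        (barlowPos 1 (Real.sqrt (2 / 3)) constHagg k i j) = 1 ↔
      (k - kp = 0 ∧ (ip - i, jp - j) ∈ sixOffsets) ∨ (k - kp = 1 ∧ (ip - i, jp - j) ∈ threeOffsets (-1)) ∨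
        (k - kp = -1 ∧ (ip - i, jp - j) ∈ threeOffsets 1) := by
  rw [dist_barlowPos_eq_iff isHaggSeq_const one_pos idealHeight_sq]
  simp only [constHagg]
  constructor
  · rintro (⟨hk, hm⟩ | ⟨hk, hm⟩ | ⟨hk, hm⟩)
    · exact Or.inl ⟨by omega, hm⟩
    · exact Or.inr (Or.inl ⟨by omega, hm⟩)
    · exact Or.inr (Or.inr ⟨by omega, hm⟩)
  · rintro (⟨hk, hm⟩ | ⟨hk, hm⟩ | ⟨hk, hm⟩)
    · exact Or.inl ⟨by omega, hm⟩
    · exact Or.inr (Or.inl ⟨by omega, hm⟩)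
    · exact Or.inr (Or.inr ⟨by omega, hm⟩)

/-! ## The witness: the point reflection through an octahedral hole of the ideal FCC stacking -/

/-- The far corner `q₀ = barlowPos 1 (−1) (−1) = −2w + h e₃` of an octahedron of the ideal FCC
stacking through the origin (`dist 0 q₀ = √2`); `q₀ / 2` is the centre of that octahedral hole,
at distance exactly the covering radius `1/√2` from its six sites. [folklore] -/
def octaCorner : E3 := barlowPos 1 (Real.sqrt (2 / 3)) constHagg 1 (-1) (-1)

/-- The point reflection `x ↦ q₀ − x` through the octahedral hole centre `q₀ / 2`. [folklore] -/
def holeInversion (x : E3) : E3 := octaCorner - x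

/-- The reflection is an involution. [folklore] -/
theorem holeInversion_involutive : Function.Involutive holeInversion := fun _ =>
  sub_sub_cancel _ _

/-- In stacking coordinates the reflection is `(k, i, j) ↦ (1 − k, −1 − i, −1 − j)`. [folklore] -/
theorem holeInversion_barlowPos (k i j : ℤ) :
    holeInversion (barlowPos 1 (Real.sqrt (2 / 3)) constHagg k i j) =
      barlowPos 1 (Real.sqrt (2 / 3)) constHagg (1 - k) (-1 - i) (-1 - j) := by
  ext l
  fin_cases l <;> simp [holeInversion, octaCorner] <;> ring

/-- The reflection maps sites to sites. [folklore] -/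
theorem holeInversion_mem {x : E3} (hx : x ∈ 𝔽) : holeInversion x ∈ 𝔽 := by
  obtain ⟨k, i, j, rfl⟩ := hx
  rw [holeInversion_barlowPos]
  exact barlowPos_mem _ _ _

/-- The reflection is a bijection of the stacking. [folklore] -/
theorem holeInversion_bijOn : Set.BijOn holeInversion 𝔽 𝔽 :=
  ⟨fun _ hx => holeInversion_mem hx, holeInversion_involutive.injective.injOn,
    fun y hy => ⟨holeInversion y, holeInversion_mem hy, holeInversion_involutive y⟩⟩

/-- The reflection is an isometry (so it preserves and reflects contacts). [folklore] -/
theorem dist_holeInversion (x y : E3) : dist (holeInversion x) (holeInversion y) = dist x y := by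
  rw [holeInversion, holeInversion, dist_eq_norm, dist_eq_norm, sub_sub_sub_cancel_left,
    norm_sub_rev]

/-- No site is fixed: the hole centre `q₀ / 2` lies at height `h / 2`, sites at heights `k h`.
[folklore] -/
theorem holeInversion_ne {x : E3} (hx : x ∈ 𝔽) : holeInversion x ≠ x := by
  obtain ⟨k, i, j, rfl⟩ := hx
  rw [holeInversion_barlowPos]
  intro h
  have h2 := congrArg (fun p : E3 => p 2) h
  simp only [barlowPos_apply_two] at h2
  have hpos : (0 : ℝ) < Real.sqrt (2 / 3) := Real.sqrt_pos.2 (by norm_num)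
  have h3 : ((1 - k : ℤ) : ℝ) = (k : ℝ) := mul_right_cancel₀ hpos.ne' h2
  have h4 : (1 - k : ℤ) = k := by exact_mod_cast h3
  omega

/-- Every site is moved by a distance `≠ 1` (in fact `≥ √2`): in stacking coordinates the
displacement has odd relative layer `1 − 2k` and odd in-layer offsets `(2i+1, 2j+1)`, which is
never an FCC bond offset (`fcc_bond_iff`; the adjacent-layer offsets have a zero entry).
[folklore] -/
theorem dist_holeInversion_ne_one {x : E3} (hx : x ∈ 𝔽) : dist x (holeInversion x) ≠ 1 := by
  obtain ⟨k, i, j, rfl⟩ := hx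
  rw [holeInversion_barlowPos, Ne, fcc_bond_iff]
  rintro (⟨hr, -⟩ | ⟨-, hm⟩ | ⟨-, hm⟩)
  · omega
  · simp [threeOffsets] at hm; omega
  · simp [threeOffsets] at hm; omega

/-! ## Load-bearing: without the far-move hypothesis the stub is false -/

/-- **`stub_powerTranslation` without its third displacement hypothesis is false**: the point
reflection of the ideal FCC stacking through an octahedral hole centre is a fixed-site-free contact
automorphism moving no site to a contact, but, being an involution, has no power equal to a non-zero
translation — any proof of the stub must use "no site is moved to a contact of a contact". [folklore] -/
theorem powerTranslation_false_without_far :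
    ¬ ∀ (s : ℤ → ℤ) (σ : E3 → E3), IsHaggSeq s →
      (Set.BijOn σ (barlowStacking 1 (Real.sqrt (2 / 3)) s) (barlowStacking 1 (Real.sqrt (2 / 3)) s) ∧
        ∀ q ∈ barlowStacking 1 (Real.sqrt (2 / 3)) s, ∀ q' ∈ barlowStacking 1 (Real.sqrt (2 / 3)) s,
          (dist (σ q) (σ q') = 1 ↔ dist q q' = 1)) →
      (∀ q ∈ barlowStacking 1 (Real.sqrt (2 / 3)) s, σ q ≠ q) →
      (∀ q ∈ barlowStacking 1 (Real.sqrt (2 / 3)) s, dist q (σ q) ≠ 1) →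
        ∃ τ : E3, τ ≠ 0 ∧
          (∀ q ∈ barlowStacking 1 (Real.sqrt (2 / 3)) s,
            q + τ ∈ barlowStacking 1 (Real.sqrt (2 / 3)) s ∧
              q - τ ∈ barlowStacking 1 (Real.sqrt (2 / 3)) s) ∧
          ∃ n : ℕ, ∀ q ∈ barlowStacking 1 (Real.sqrt (2 / 3)) s, σ^[n] q = q + τ := by
  intro h
  obtain ⟨τ, hτ, -, n, hn⟩ := h constHagg holeInversion isHaggSeq_const
    ⟨holeInversion_bijOn, fun q _ q' _ => by rw [dist_holeInversion]⟩
    (fun q hq => holeInversion_ne hq) (fun q hq => dist_holeInversion_ne_one hq)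
  have h0 : barlowPos 1 (Real.sqrt (2 / 3)) constHagg 0 0 0 ∈ 𝔽 := barlowPos_mem _ _ _
  have h1 : octaCorner ∈ 𝔽 := barlowPos_mem _ _ _
  have hpos : (0 : ℝ) < Real.sqrt (2 / 3) := Real.sqrt_pos.2 (by norm_num)
  rcases Nat.even_or_odd n with he | ho
  · -- an even power is the identity: `p₀ = p₀ + τ` forces `τ = 0`
    have e0 := hn _ h0
    rw [holeInversion_involutive.iterate_even he, id_eq] at e0
    have : τ = 0 := by simpa using e0.symm
    exact hτ this
  · -- an odd power is the reflection itself: read the heights of `σ 0 = 0 + τ`, `σ q₀ = q₀ + τ`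
    have e0 := hn _ h0
    have e1 := hn _ h1
    rw [holeInversion_involutive.iterate_odd ho] at e0 e1
    have h2 := congrArg (fun p : E3 => p 2) e0
    have h3 := congrArg (fun p : E3 => p 2) e1
    simp only [holeInversion, octaCorner, PiLp.sub_apply, PiLp.add_apply, barlowPos_apply_two] at h2 h3
    push_cast at h2 h3
    linarith

/-! ## Redundancy: the two near-move hypotheses follow from the far-move one -/

/-- **The first two displacement hypotheses of `stub_powerTranslation` follow from the third**,
for every Hägg `s` and every site-preserving self-map `σ`: no site is fixed (every site `q` has a
contact `m`, and `σ q = q` would make `σ q` a contact of `m`) and no site is moved to a contact (a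
contact pair `q, σ q` has four common contacts, `ncard_commonTouching_eq_four`). [folklore] -/
theorem powerTranslation_hyps_of_far {s : ℤ → ℤ} (hs : IsHaggSeq s) {σ : E3 → E3}
    (hσ : Set.MapsTo σ (barlowStacking 1 (Real.sqrt (2 / 3)) s) (barlowStacking 1 (Real.sqrt (2 / 3)) s))
    (h3 : ∀ q ∈ barlowStacking 1 (Real.sqrt (2 / 3)) s, ∀ m ∈ barlowStacking 1 (Real.sqrt (2 / 3)) s,
      dist q m = 1 → dist m (σ q) ≠ 1) :
    (∀ q ∈ barlowStacking 1 (Real.sqrt (2 / 3)) s, σ q ≠ q) ∧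
      (∀ q ∈ barlowStacking 1 (Real.sqrt (2 / 3)) s, dist q (σ q) ≠ 1) := by
  refine ⟨fun q hq hfix => ?_, fun q hq hq1 => ?_⟩
  · obtain ⟨k, i, j, rfl⟩ := hq
    have hm : barlowPos 1 (Real.sqrt (2 / 3)) s (k + 1) i j ∈ barlowStacking 1 (Real.sqrt (2 / 3)) s :=
      barlowPos_mem _ _ _
    have hd : dist (barlowPos 1 (Real.sqrt (2 / 3)) s (k + 1) i j)
        (barlowPos 1 (Real.sqrt (2 / 3)) s k i j) = 1 := by
      rw [dist_barlowPos_succ_eq (a := 1) (h := Real.sqrt (2 / 3)) hs, Real.sq_sqrt (by norm_num)]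
      norm_num
    have key := h3 _ (barlowPos_mem _ _ _) _ hm (by rw [dist_comm]; exact hd)
    rw [hfix] at key
    exact key hd
  · have h4 := ncard_commonTouching_eq_four hs one_pos idealHeight_sq hq (hσ hq) hq1
    have hne : {w | w ∈ barlowStacking 1 (Real.sqrt (2 / 3)) s ∧ dist q w = 1 ∧ dist (σ q) w = 1}.Nonempty :=
      Set.nonempty_of_ncard_ne_zero (by rw [h4]; norm_num)
    obtain ⟨w, hw, hqw, hσw⟩ := hne
    exact h3 q hq w hw hqw (by rw [dist_comm]; exact hσw)

/-! ## Consistency: the hypothesis set is satisfiable, and then the conclusion is attained -/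

/-- The in-layer period `3u` of every Barlow stacking. [folklore] -/
def threeU : E3 := (3 : ℝ) • triangularVec₁ 1

/-- Translating by `3u` shifts the first in-layer index by `3`. [folklore] -/
theorem barlowPos_add_threeU (s : ℤ → ℤ) (k i j : ℤ) :
    barlowPos 1 (Real.sqrt (2 / 3)) s k i j + threeU = barlowPos 1 (Real.sqrt (2 / 3)) s k (i + 3) j := by
  ext l
  fin_cases l
  · simp [threeU, triangularVec₁]; ring
  · simp [threeU, triangularVec₁]
  · simp [threeU, triangularVec₁]

/-- `‖3u‖ = 3`. [folklore] -/
theorem norm_threeU : ‖threeU‖ = 3 := by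
  have h := barlowPos_add_threeU constHagg 0 0 0
  rw [zero_add] at h
  have h' : threeU = barlowPos 1 (Real.sqrt (2 / 3)) constHagg 0 3 0 -
      barlowPos 1 (Real.sqrt (2 / 3)) constHagg 0 0 0 := by
    rw [← h, add_sub_cancel_left]
  rw [h', ← dist_eq_norm, dist_comm]
  have hsq := dist_barlowPos_sq 1 (Real.sqrt (2 / 3)) constHagg 0 0 0 0 3 0
  have hd : (0 : ℝ) ≤ dist (barlowPos 1 (Real.sqrt (2 / 3)) constHagg 0 0 0)
      (barlowPos 1 (Real.sqrt (2 / 3)) constHagg 0 3 0) := dist_nonneg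
  simp only [haggLabel_const] at hsq
  push_cast at hsq
  have h9 : dist (barlowPos 1 (Real.sqrt (2 / 3)) constHagg 0 0 0)
      (barlowPos 1 (Real.sqrt (2 / 3)) constHagg 0 3 0) ^ 2 = 3 ^ 2 := by
    linear_combination hsq
  exact (pow_left_inj₀ hd (by norm_num) two_ne_zero).1 h9

/-- **The hypotheses of `stub_powerTranslation` are jointly satisfiable, with the conclusion
attained at `n = 1`**: for every `s` the in-layer translation by `3u` is a contact automorphism of
`barlowStacking 1 √(2/3) s` moving every site by `3` (graph distance `3`), and it is itself a
non-zero two-sided period.  (Non-vacuity check of the stub; no Hägg hypothesis is needed for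
this instance.) [folklore] -/
theorem powerTranslation_hyps_satisfiable (s : ℤ → ℤ) :
    ∃ σ : E3 → E3,
      (Set.BijOn σ (barlowStacking 1 (Real.sqrt (2 / 3)) s) (barlowStacking 1 (Real.sqrt (2 / 3)) s) ∧
        ∀ q ∈ barlowStacking 1 (Real.sqrt (2 / 3)) s, ∀ q' ∈ barlowStacking 1 (Real.sqrt (2 / 3)) s,
          (dist (σ q) (σ q') = 1 ↔ dist q q' = 1)) ∧
      (∀ q ∈ barlowStacking 1 (Real.sqrt (2 / 3)) s, σ q ≠ q) ∧
      (∀ q ∈ barlowStacking 1 (Real.sqrt (2 / 3)) s, dist q (σ q) ≠ 1) ∧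
      (∀ q ∈ barlowStacking 1 (Real.sqrt (2 / 3)) s, ∀ m ∈ barlowStacking 1 (Real.sqrt (2 / 3)) s,
        dist q m = 1 → dist m (σ q) ≠ 1) ∧
      ∃ τ : E3, τ ≠ 0 ∧
        (∀ q ∈ barlowStacking 1 (Real.sqrt (2 / 3)) s,
          q + τ ∈ barlowStacking 1 (Real.sqrt (2 / 3)) s ∧ q - τ ∈ barlowStacking 1 (Real.sqrt (2 / 3)) s) ∧
        ∃ n : ℕ, ∀ q ∈ barlowStacking 1 (Real.sqrt (2 / 3)) s, σ^[n] q = q + τ := by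
  have hmem : ∀ q ∈ barlowStacking 1 (Real.sqrt (2 / 3)) s,
      q + threeU ∈ barlowStacking 1 (Real.sqrt (2 / 3)) s ∧ q - threeU ∈ barlowStacking 1 (Real.sqrt (2 / 3)) s := by
    rintro q ⟨k, i, j, rfl⟩
    refine ⟨by rw [barlowPos_add_threeU]; exact barlowPos_mem _ _ _, ⟨k, i - 3, j, ?_⟩⟩
    rw [sub_eq_iff_eq_add, barlowPos_add_threeU, sub_add_cancel]
  have hne : threeU ≠ 0 := by
    intro h0; have h3 := norm_threeU; rw [h0, norm_zero] at h3; norm_num at h3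
  have hd3 : ∀ q : E3, dist q (q + threeU) = 3 := fun q => by
    rw [dist_self_add_right, norm_threeU]
  refine ⟨fun x => x + threeU, ⟨⟨fun q hq => (hmem q hq).1, (add_left_injective threeU).injOn,
    fun y hy => ⟨y - threeU, (hmem y hy).2, sub_add_cancel y threeU⟩⟩,
    fun q _ q' _ => by rw [dist_add_right]⟩, fun q _ h => hne (by simpa using h),
    fun q _ h => by rw [hd3] at h; norm_num at h, fun q _ m _ hqm h1 => ?_,
    threeU, hne, hmem, 1, fun q _ => by rw [Function.iterate_one]⟩
  have ht := dist_triangle q m (q + threeU)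
  rw [hd3, hqm, h1] at ht
  norm_num at ht

/-! ## Calibration of the transport interface (lead reshape, cycle 1): the ideal stacking itself
carries a transport system — the interface of `stub_transportSystem` / `stub_developCovering` is
inhabited by the intended model, with the SAME sign conventions (`linkOffsets (par (V⁻¹ f)) (par f)`,
frames `V^r (J^(−Q) (I^(−P) f))` ↔ `relPos k i j (r,P,Q) = barlowPos (k+r) (i−P) (j−Q)`). -/

/-- The bond window stays below the second shell: `28/25 < √2`. [folklore] -/
theorem window_lt_sqrt_two : (28 / 25 : ℝ) < Real.sqrt 2 * 1 := by
  rw [mul_one, show (28 / 25 : ℝ) = Real.sqrt ((28 / 25) ^ 2) by rw [Real.sqrt_sq]; norm_num]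
  exact Real.sqrt_lt_sqrt (by norm_num) (by norm_num)

/-- In-layer shift of the first index (frame transport `I` of the coordinate model). [folklore] -/
def frameI : Equiv.Perm (ℤ × ℤ × ℤ) := Equiv.addRight ((0, 1, 0) : ℤ × ℤ × ℤ)
/-- In-layer shift of the second index (frame transport `J` of the coordinate model). [folklore] -/
def frameJ : Equiv.Perm (ℤ × ℤ × ℤ) := Equiv.addRight ((0, 0, 1) : ℤ × ℤ × ℤ)
/-- Layer shift (frame transport `V` of the coordinate model). [folklore] -/
def frameV : Equiv.Perm (ℤ × ℤ × ℤ) := Equiv.addRight ((1, 0, 0) : ℤ × ℤ × ℤ)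

/-- Frame arithmetic of the coordinate model. [folklore] -/
theorem frame_apply (f : ℤ × ℤ × ℤ) (r p q : ℤ) :
    (frameV ^ r) ((frameJ ^ q) ((frameI ^ p) f)) = (f.1 + r, f.2.1 + p, f.2.2 + q) := by
  obtain ⟨k, i, j⟩ := f
  simp only [frameI, frameJ, frameV, Equiv.zsmul_addRight, Equiv.coe_addRight, Prod.smul_mk,
    smul_eq_mul, mul_zero, mul_one, Prod.mk_add_mk, add_zero]

/-- The inverse layer shift. [folklore] -/
theorem frameV_inv_apply (f : ℤ × ℤ × ℤ) : frameV⁻¹ f = (f.1 - 1, f.2.1, f.2.2) := by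
  obtain ⟨k, i, j⟩ := f
  simp only [frameV, Equiv.neg_addRight, Equiv.coe_addRight, Prod.neg_mk, neg_zero, Prod.mk_add_mk,
    add_zero, sub_eq_add_neg]

/-- **The ideal stacking is a transport system over itself** (non-vacuity / convention check of
the interface `TransportSystem` of the reshaped line, stated verbatim with
`S := barlowStacking 1 √(2/3) s`): frames `ℤ³`, `pt (k,i,j) = barlowPos k i j`, `I, J, V` the
coordinate shifts, `par (k,i,j) = s k`, base frame `0`.  The star and link clauses are exactly
`touching_iff_exists_linkOffsets` / `dist_relPos_eq_iff_linkAdj` (`BarlowRings.lean`) read through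
the distance gap (`dist_eq_of_dist_le_of_lt`: a window pair of the ideal stacking is a contact).
[folklore] -/
theorem transportSystem_barlowStacking {s : ℤ → ℤ} (hs : IsHaggSeq s) :
    ∃ (F : Type) (pt : F → E3) (I J V : Equiv.Perm F) (par : F → ℤ) (f₀ : F),
      (∀ f, I (J f) = J (I f)) ∧ (∀ f, I (V f) = V (I f)) ∧ (∀ f, J (V f) = V (J f)) ∧
      (∀ f, pt f ∈ barlowStacking 1 (Real.sqrt (2 / 3)) s) ∧
      (∀ f, par f = 1 ∨ par f = -1) ∧ (∀ f, par (I f) = par f) ∧ (∀ f, par (J f) = par f) ∧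
      (∀ y ∈ barlowStacking 1 (Real.sqrt (2 / 3)) s, ∃ a b c : ℤ, pt ((V ^ c) ((J ^ b) ((I ^ a) f₀))) = y) ∧
      (∀ f, Set.BijOn (fun x : ℤ × ℤ × ℤ => pt ((V ^ x.1) ((J ^ (-x.2.2)) ((I ^ (-x.2.1)) f))))
          (↑(linkOffsets (par (V⁻¹ f)) (par f)) : Set (ℤ × ℤ × ℤ))
          {y | y ∈ barlowStacking 1 (Real.sqrt (2 / 3)) s ∧ (0 < dist (pt f) y ∧ dist (pt f) y ≤ 28 / 25)}) ∧
      (∀ f, ∀ x ∈ linkOffsets (par (V⁻¹ f)) (par f), ∀ y ∈ linkOffsets (par (V⁻¹ f)) (par f),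
          ((0 < dist (pt ((V ^ x.1) ((J ^ (-x.2.2)) ((I ^ (-x.2.1)) f))))
                  (pt ((V ^ y.1) ((J ^ (-y.2.2)) ((I ^ (-y.2.1)) f)))) ∧
            dist (pt ((V ^ x.1) ((J ^ (-x.2.2)) ((I ^ (-x.2.1)) f))))
                  (pt ((V ^ y.1) ((J ^ (-y.2.2)) ((I ^ (-y.2.1)) f)))) ≤ 28 / 25) ↔
            linkAdj (par (V⁻¹ f)) (par f) x y)) := by
  have hh : Real.sqrt (2 / 3) ^ 2 = 2 / 3 * (1 : ℝ) ^ 2 := idealHeight_sq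
  -- the frame map IS `relPos`
  have hpt : ∀ (f x : ℤ × ℤ × ℤ),
      barlowPos 1 (Real.sqrt (2 / 3)) s ((frameV ^ x.1) ((frameJ ^ (-x.2.2)) ((frameI ^ (-x.2.1)) f))).1
          ((frameV ^ x.1) ((frameJ ^ (-x.2.2)) ((frameI ^ (-x.2.1)) f))).2.1
          ((frameV ^ x.1) ((frameJ ^ (-x.2.2)) ((frameI ^ (-x.2.1)) f))).2.2 =
        relPos 1 (Real.sqrt (2 / 3)) s f.1 f.2.1 f.2.2 x := by
    intro f x
    rw [frame_apply]
    simp only [relPos, offsetPos, ← sub_eq_add_neg]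
  -- members of the shell are sites at distance `1`
  have hshell : ∀ (f x : ℤ × ℤ × ℤ), x ∈ linkOffsets (s (f.1 - 1)) (s f.1) →
      relPos 1 (Real.sqrt (2 / 3)) s f.1 f.2.1 f.2.2 x ∈ barlowStacking 1 (Real.sqrt (2 / 3)) s ∧
        dist (barlowPos 1 (Real.sqrt (2 / 3)) s f.1 f.2.1 f.2.2)
          (relPos 1 (Real.sqrt (2 / 3)) s f.1 f.2.1 f.2.2 x) = 1 :=
    fun f x hx => (touching_iff_exists_linkOffsets hs one_pos hh f.1 f.2.1 f.2.2 _).2 ⟨x, hx, rfl⟩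
  -- a window pair of sites is a contact
  have hwin : ∀ u ∈ barlowStacking 1 (Real.sqrt (2 / 3)) s, ∀ w ∈ barlowStacking 1 (Real.sqrt (2 / 3)) s,
      (0 < dist u w ∧ dist u w ≤ 28 / 25) ↔ dist u w = 1 := by
    intro u hu w hw
    constructor
    · rintro ⟨h0, hle⟩
      have hne : u ≠ w := by
        intro e
        rw [e, dist_self] at h0
        exact lt_irrefl _ h0
      exact dist_eq_of_dist_le_of_lt hs one_pos hh hu hw hne window_lt_sqrt_two hle
    · intro h1
      rw [h1]
      norm_num
  refine ⟨ℤ × ℤ × ℤ, fun f => barlowPos 1 (Real.sqrt (2 / 3)) s f.1 f.2.1 f.2.2, frameI, frameJ, frameV,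
    fun f => s f.1, (0, 0, 0), ?_, ?_, ?_, fun f => barlowPos_mem _ _ _, fun f => hs f.1, ?_, ?_, ?_, ?_, ?_⟩
  · intro f; simp only [frameI, frameJ, Equiv.coe_addRight]; exact add_right_comm _ _ _
  · intro f; simp only [frameI, frameV, Equiv.coe_addRight]; exact add_right_comm _ _ _
  · intro f; simp only [frameJ, frameV, Equiv.coe_addRight]; exact add_right_comm _ _ _
  · intro f; simp [frameI]
  · intro f; simp [frameJ]
  · rintro y ⟨k, i, j, rfl⟩
    refine ⟨i, j, k, ?_⟩
    simp only [frame_apply, zero_add]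
  · intro f
    simp only [frameV_inv_apply]
    have hfun : (fun x : ℤ × ℤ × ℤ => barlowPos 1 (Real.sqrt (2 / 3)) s
        ((frameV ^ x.1) ((frameJ ^ (-x.2.2)) ((frameI ^ (-x.2.1)) f))).1
        ((frameV ^ x.1) ((frameJ ^ (-x.2.2)) ((frameI ^ (-x.2.1)) f))).2.1
        ((frameV ^ x.1) ((frameJ ^ (-x.2.2)) ((frameI ^ (-x.2.1)) f))).2.2) =
        relPos 1 (Real.sqrt (2 / 3)) s f.1 f.2.1 f.2.2 := funext (hpt f)
    rw [hfun]
    refine ⟨fun x hx => ?_, (relPos_injective one_pos hh f.1 f.2.1 f.2.2).injOn, fun y hy => ?_⟩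
    · obtain ⟨hmem, hd⟩ := hshell f x hx
      exact ⟨hmem, by rw [hd]; norm_num, by rw [hd]; norm_num⟩
    · obtain ⟨hyB, hwy⟩ := hy
      have hd1 : dist (barlowPos 1 (Real.sqrt (2 / 3)) s f.1 f.2.1 f.2.2) y = 1 :=
        (hwin _ (barlowPos_mem _ _ _) y hyB).1 hwy
      obtain ⟨x, hx, hxy⟩ := (touching_iff_exists_linkOffsets hs one_pos hh f.1 f.2.1 f.2.2 y).1 ⟨hyB, hd1⟩
      exact ⟨x, hx, hxy⟩
  · intro f x hx y hy
    simp only [frameV_inv_apply] at hx hy ⊢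
    rw [hpt f x, hpt f y, hwin _ (hshell f x hx).1 _ (hshell f y hy).1]
    exact dist_relPos_eq_iff_linkAdj hs one_pos hh f.1 f.2.1 f.2.2 (fst_mem_of_mem_linkOffsets hx)
      (fst_mem_of_mem_linkOffsets hy)

end Summit.AtomisticToContinuum.Crystallization.Theorems.ShellsToBarlowChartNegative
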